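import Summits.Ventures.Crystal3D.Theorems.StickyWulffConstantPolycrystalWulffBoundRungSingleAxisTextureFree

/-!
# `PolycrystalWulffBound`, line `PolyDensity`: single-axis twin textures of ARBITRARY geometry at
# twin-wall charge `c ≥ 4/(3√6) = 0.5443` satisfy `6·2^{1/3}(√2·Vol)^{2/3} ≤ En` — no azimuth test
# (crux `stmt-Ventures-19482`)

Route `StickyWulffConstant` of the venture `Summits/Ventures/Crystal3D`, second prover lane (poly-p2,
gen 10).  Averaging the free-form rung (`rung_singleAxis_texture_free`, `…RungSingleAxisTextureFree`)
over the three horizontal `⟨112⟩` directions and bounding `|⟪w,ν⟫| + |⟪w₂,ν⟫| + |⟪w₃,ν⟫| ≤ 2 sin∠(ν,m₀)`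
(`three_dir_abs_sum_le`): a crux texture `Tex n G A c m` presented by cells, all frames co-axial about
`m₀`, Bool lattice labels, wall data recording the axis, three (bond, `⟨112⟩`) pairs `(u_k, w_k)`, and
twin walls charged `c f g ≥ 4/(3√6)` across the two lattice classes ⇒
`6·2^{1/3}(√2·Vol)^{2/3} ≤ En n G A c m` (`rung_singleAxis_texture_of_charge`).  `4/(3√6) = 0.5443…`
is the exact ceiling of the slide/transport family (Knothe-flag LP, seat memo P-SLIDE-g10 §2); the law of
record charges `½`, where the aggregate azimuth test of `rung_singleAxis_texture` is needed instead.
WHAT THIS IS NOT: the law of record; multi-axis colonies; the crux is not claimed.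
-/

noncomputable section

open scoped BigOperators InnerProductSpace ENNReal Pointwise
open MeasureTheory Filter Set

namespace Summit.Ventures.Crystal3D.Cruxes.PolycrystalWulffBound.PolyDensity

open Summit.Ventures.Crystal3D.Theorems
open Summit.Ventures.Crystal3D.Cruxes.TextureLiminf.TexShadow (per polytope facetArea supportFn E3
  PolytopeCalculus stub_polytopeCalculus)
open Literature.MathematicalPhysics.StatisticalMechanics (fccStacking barlowStacking IsHaggSeq perimeter)

/-- **Single-axis textures at twin-wall charge `≥ 4/(3√6)`** satisfy the polycrystal Wulff bound,
whatever their polyhedral geometry. -/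
theorem rung_singleAxis_texture_of_charge :
    let Λ : Set (EuclideanSpace ℝ (Fin 3)) := Literature.MathematicalPhysics.StatisticalMechanics.fccStacking 1 (Real.sqrt (2 / 3));
    let Brl : (ℤ → ℤ) → Set (EuclideanSpace ℝ (Fin 3)) := Literature.MathematicalPhysics.StatisticalMechanics.barlowStacking 1 (Real.sqrt (2 / 3));
    let Ax : EuclideanSpace ℝ (Fin 3) → (EuclideanSpace ℝ (Fin 3) ≃ₗᵢ[ℝ] EuclideanSpace ℝ (Fin 3)) → (EuclideanSpace ℝ (Fin 3) ≃ₗᵢ[ℝ] EuclideanSpace ℝ (Fin 3)) → Prop := fun m A B => ∃ (L : EuclideanSpace ℝ (Fin 3) ≃ₗᵢ[ℝ] EuclideanSpace ℝ (Fin 3)) (s₁ s₂ : EuclideanSpace ℝ (Fin 3)) (σ σ' : ℤ → ℤ), Literature.MathematicalPhysics.StatisticalMechanics.IsHaggSeq σ ∧ Literature.MathematicalPhysics.StatisticalMechanics.IsHaggSeq σ' ∧ L (EuclideanSpace.single (2 : Fin 3) (1 : ℝ)) = m ∧ A '' Λ ⊆ (fun q => L q + s₁) '' Brl σ ∧ B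 '' Λ ⊆ (fun q => L q + s₂) '' Brl σ';
    let CoAx : (EuclideanSpace ℝ (Fin 3) ≃ₗᵢ[ℝ] EuclideanSpace ℝ (Fin 3)) → (EuclideanSpace ℝ (Fin 3) ≃ₗᵢ[ℝ] EuclideanSpace ℝ (Fin 3)) → Prop := fun A B => ∃ m, Ax m A B;
    let Φ : EuclideanSpace ℝ (Fin 3) → ℝ := fun ν => Real.sqrt 2 / 4 * ∑ᶠ w ∈ {w ∈ Λ | ‖w‖ = 1}, |⟪w, ν⟫_ℝ|;
    let Per : Set (EuclideanSpace ℝ (Fin 3)) → Set (EuclideanSpace ℝ (Fin 3)) → ℝ := fun K S => (⨆ (ξ : EuclideanSpace ℝ (Fin 3) → EuclideanSpace ℝ (Fin 3)) (_ : ContDiff ℝ 1 ξ ∧ HasCompactSupport ξ ∧ ∀ z, ξ z ∈ K), ENNReal.ofReal (∫ z in S, Literature.MathematicalPhysics.StatisticalMechanics.fieldDivergence ξ z)).toReal;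
    let ι : Set (EuclideanSpace ℝ (Fin 3)) → Set (EuclideanSpace ℝ (Fin 3)) → Set (EuclideanSpace ℝ (Fin 3)) → ℝ := fun K S₁ S₂ => (Per K S₁ + Per K S₂ - Per K (S₁ ∪ S₂)) / 2;
    let W : (EuclideanSpace ℝ (Fin 3) ≃ₗᵢ[ℝ] EuclideanSpace ℝ (Fin 3)) → Set (EuclideanSpace ℝ (Fin 3)) := fun A => {y | ∀ ν : EuclideanSpace ℝ (Fin 3), ⟪y, ν⟫_ℝ ≤ Φ (A.symm ν)};
    let Dsc : EuclideanSpace ℝ (Fin 3) → Set (EuclideanSpace ℝ (Fin 3)) := fun m => {y | ‖y‖ ≤ 1 ∧ ⟪y, m⟫_ℝ = 0};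
    let Tex : (n : ℕ) → (Fin n → Set (EuclideanSpace ℝ (Fin 3))) → (Fin n → (EuclideanSpace ℝ (Fin 3) ≃ₗᵢ[ℝ] EuclideanSpace ℝ (Fin 3))) → (Fin n → Fin n → ℝ) → (Fin n → Fin n → EuclideanSpace ℝ (Fin 3)) → Prop := fun n G A c m => (∀ f : Fin n, Literature.MathematicalPhysics.StatisticalMechanics.HasFinitePerimeter (G f) ∧ volume (G f) < ⊤) ∧ (∀ f g, f ≠ g → Disjoint (G f) (G g)) ∧ (∀ f g, f ≠ g → 0 ≤ c f g) ∧ (∀ f g, f ≠ g → ¬ CoAx (A f) (A g) → m f g = 0 ∧ 1 ≤ c f g) ∧ (∀ f g, f ≠ g → CoAx (A f) (A g) → A f '' Λ ≠ A g '' Λ → Ax (m f g) (A f) (A g) ∧ 1 / 2 ≤ c f g);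
    let En : (n : ℕ) → (Fin n → Set (EuclideanSpace ℝ (Fin 3))) → (Fin n → (EuclideanSpace ℝ (Fin 3) ≃ₗᵢ[ℝ] EuclideanSpace ℝ (Fin 3))) → (Fin n → Fin n → ℝ) → (Fin n → Fin n → EuclideanSpace ℝ (Fin 3)) → ℝ := fun n G A c m => ∑ f : Fin n, Per (W (A f)) (G f) - ∑ f, ∑ g, (if f = g then 0 else ι (W (A f)) (G f) (G g)) + ∑ f, ∑ g, (if f = g then 0 else c f g / 2 * ι (Dsc (m f g)) (G f) (G g));
    let Vol : (n : ℕ) → (Fin n → Set (EuclideanSpace ℝ (Fin 3))) → ℝ := fun n G => (volume (⋃ f : Fin n, G f)).toReal;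
    ∀ (k' : ℕ) (Hc : Fin k' → Finset ((EuclideanSpace ℝ (Fin 3)) × ℝ)) (nv : Fin k' → Fin k' → EuclideanSpace ℝ (Fin 3)),
      (∀ j, Bornology.IsBounded (polytope (Hc j))) →
      (∀ j j', j ≠ j' → Disjoint (polytope (Hc j)) (polytope (Hc j'))) →
      (∀ i j, nv j i = -nv i j) →
      (∀ j j', j ≠ j' → ‖nv j j'‖ = 1 ∧ ∃ b : ℝ,
        closure (polytope (Hc j)) ∩ closure (polytope (Hc j')) ⊆ {x | ⟪nv j j', x⟫_ℝ = b}) →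
    ∀ (n : ℕ) (G : Fin n → Set (EuclideanSpace ℝ (Fin 3)))
      (A : Fin n → (EuclideanSpace ℝ (Fin 3) ≃ₗᵢ[ℝ] EuclideanSpace ℝ (Fin 3)))
      (c : Fin n → Fin n → ℝ) (m : Fin n → Fin n → EuclideanSpace ℝ (Fin 3)),
      Tex n G A c m →
    ∀ (s : Fin n → Finset (Fin k')),
      (∀ f, G f = ⋃ j ∈ s f, polytope (Hc j)) →
      (∀ f g, f ≠ g → Disjoint (s f) (s g)) →
      (∀ j, ∃ f, j ∈ s f) →
    ∀ (τ : Fin n → Bool), (∀ f g, τ f = τ g → A f '' Λ = A g '' Λ) → (∀ f g, τ f ≠ τ g → A f '' Λ ≠ A g '' Λ) →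
    ∀ (m₀ u w : EuclideanSpace ℝ (Fin 3)), (∀ f g, Ax m₀ (A f) (A g)) → (∀ f g, f ≠ g → τ f ≠ τ g → m f g = m₀) →
      ‖u‖ = 1 → ‖w‖ = 1 → ⟪u, m₀⟫_ℝ = 0 → ⟪w, m₀⟫_ℝ = 0 → ⟪w, u⟫_ℝ = 0 →
      (∀ f, u ∈ A f '' Λ) → (∀ f, (ℝ ∙ u)ᗮ.reflection '' (A f '' Λ) = A f '' Λ) →
    ∀ (u₂ w₂ u₃ w₃ : EuclideanSpace ℝ (Fin 3)),
      w₂ = (Real.sqrt 3 / 2) • u - (1 / 2 : ℝ) • w → w₃ = -(Real.sqrt 3 / 2) • u - (1 / 2 : ℝ) • w →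
      ‖u₂‖ = 1 → ⟪u₂, m₀⟫_ℝ = 0 → ⟪w₂, u₂⟫_ℝ = 0 →
      (∀ f, u₂ ∈ A f '' Λ) → (∀ f, (ℝ ∙ u₂)ᗮ.reflection '' (A f '' Λ) = A f '' Λ) →
      ‖u₃‖ = 1 → ⟪u₃, m₀⟫_ℝ = 0 → ⟪w₃, u₃⟫_ℝ = 0 →
      (∀ f, u₃ ∈ A f '' Λ) → (∀ f, (ℝ ∙ u₃)ᗮ.reflection '' (A f '' Λ) = A f '' Λ) →
      (∀ f g, f ≠ g → τ f ≠ τ g → 4 / (3 * Real.sqrt 6) ≤ c f g) →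
    6 * (2 : ℝ) ^ ((1 : ℝ) / 3) * (Real.sqrt 2 * Vol n G) ^ ((2 : ℝ) / 3) ≤ En n G A c m := by
  intro Λ Brl Ax CoAx Φ Per ι W Dsc Tex En Vol k' Hc nv hbd hdisjQ hanti hplane n G A c m hTex
    s hGs hsdisj hcov τ hτ1 hτ2 m₀ u w hAx hmax hu hw hum hwm hwu hbond hmir
    u₂ w₂ u₃ w₃ hw₂ hw₃ hu₂ hu₂m hwu₂ hbond₂ hmir₂ hu₃ hu₃m hwu₃ hbond₃ hmir₃ hc
  classical
  have hTex' := hTex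
  obtain ⟨hfin, hdisjG, hc0, -, htwin⟩ := hTex'
  have hvol : ∀ f, volume (G f) < ⊤ := fun f => (hfin f).2
  have hPC := stub_polytopeCalculus
  rcases Nat.eq_zero_or_pos n with hn | hn
  · subst hn
    show 6 * (2 : ℝ) ^ ((1 : ℝ) / 3) * (Real.sqrt 2 * (volume (⋃ f : Fin 0, G f)).toReal) ^ ((2 : ℝ) / 3) ≤
      ∑ f : Fin 0, Per (W (A f)) (G f) - ∑ f : Fin 0, ∑ g, (if f = g then 0 else ι (W (A f)) (G f) (G g)) +
        ∑ f : Fin 0, ∑ g, (if f = g then 0 else c f g / 2 * ι (Dsc (m f g)) (G f) (G g))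
    rw [iUnion_of_empty, measure_empty, ENNReal.toReal_zero, mul_zero, Real.zero_rpow (by norm_num),
      mul_zero]
    simp
  have hm₀ : ‖m₀‖ = 1 := by
    obtain ⟨L, -, -, -, -, -, -, hLm, -, -⟩ := hAx ⟨0, hn⟩ ⟨0, hn⟩
    rw [← hLm, LinearIsometryEquiv.norm_map, PiLp.norm_single, norm_one]
  -- the two other `⟨112⟩` directions
  have h3 : Real.sqrt 3 ^ 2 = 3 := Real.sq_sqrt (by norm_num)
  have huu : ⟪u, u⟫_ℝ = 1 := by rw [real_inner_self_eq_norm_sq, hu, one_pow]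
  have hww : ⟪w, w⟫_ℝ = 1 := by rw [real_inner_self_eq_norm_sq, hw, one_pow]
  have huw : ⟪u, w⟫_ℝ = 0 := by rw [real_inner_comm]; exact hwu
  have hnormw : ∀ (ε : ℝ), ε = 1 ∨ ε = -1 → ‖(ε * (Real.sqrt 3 / 2)) • u - (1 / 2 : ℝ) • w‖ = 1 ∧
      ⟪(ε * (Real.sqrt 3 / 2)) • u - (1 / 2 : ℝ) • w, m₀⟫_ℝ = 0 := by
    intro ε hε
    have hε2 : ε ^ 2 = 1 := by rcases hε with h | h <;> rw [h] <;> norm_num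
    constructor
    · have hsq : ‖(ε * (Real.sqrt 3 / 2)) • u - (1 / 2 : ℝ) • w‖ ^ 2 = 1 := by
        rw [← real_inner_self_eq_norm_sq, inner_sub_left, inner_sub_right, inner_sub_right,
          real_inner_smul_left, real_inner_smul_left, real_inner_smul_right, real_inner_smul_right,
          real_inner_smul_left, real_inner_smul_right, real_inner_smul_left, real_inner_smul_right,
          huu, hww, huw, hwu]
        nlinarith [h3, hε2]
      nlinarith [norm_nonneg ((ε * (Real.sqrt 3 / 2)) • u - (1 / 2 : ℝ) • w), hsq]
    · rw [inner_sub_left, real_inner_smul_left, real_inner_smul_left, hum, hwm, mul_zero, mul_zero,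
        sub_zero]
  have hw₂' : w₂ = (1 * (Real.sqrt 3 / 2)) • u - (1 / 2 : ℝ) • w := by rw [hw₂, one_mul]
  have hw₃' : w₃ = (-1 * (Real.sqrt 3 / 2)) • u - (1 / 2 : ℝ) • w := by
    rw [hw₃, neg_one_mul, neg_smul]
  have hw₂n : ‖w₂‖ = 1 := by rw [hw₂']; exact (hnormw 1 (Or.inl rfl)).1
  have hw₂m : ⟪w₂, m₀⟫_ℝ = 0 := by rw [hw₂']; exact (hnormw 1 (Or.inl rfl)).2
  have hw₃n : ‖w₃‖ = 1 := by rw [hw₃']; exact (hnormw (-1) (Or.inr rfl)).1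
  have hw₃m : ⟪w₃, m₀⟫_ℝ = 0 := by rw [hw₃']; exact (hnormw (-1) (Or.inr rfl)).2
  -- the three free-form rungs
  have R₁ := rung_singleAxis_texture_free k' Hc nv hbd hdisjQ hanti hplane n G A c m hTex s hGs hsdisj hcov
    τ hτ1 m₀ u w hAx hu hw hum hwm hwu hbond hmir
  have R₂ := rung_singleAxis_texture_free k' Hc nv hbd hdisjQ hanti hplane n G A c m hTex s hGs hsdisj hcov
    τ hτ1 m₀ u₂ w₂ hAx hu₂ hw₂n hu₂m hw₂m hwu₂ hbond₂ hmir₂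
  have R₃ := rung_singleAxis_texture_free k' Hc nv hbd hdisjQ hanti hplane n G A c m hTex s hGs hsdisj hcov
    τ hτ1 m₀ u₃ w₃ hAx hu₃ hw₃n hu₃m hw₃m hwu₃ hbond₃ hmir₃
  -- abbreviations
  set fa : Fin k' → Fin k' → ℝ := fun a b =>
    facetArea (closure (polytope (Hc a)) ∩ closure (polytope (Hc b))) (nv a b) with hfa
  have hfa0 : ∀ a b, 0 ≤ fa a b := fun a b => ENNReal.toReal_nonneg
  set Z : ℝ := ∑ f, ∑ g, (if τ f = τ g then 0 else ∑ a ∈ s f, ∑ b ∈ s g,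
    Real.sqrt (1 - ⟪nv a b, m₀⟫_ℝ ^ 2) * fa a b) with hZ
  set Y : E3 → ℝ := fun v => ∑ f, ∑ g, (if τ f = τ g then 0 else ∑ a ∈ s f, ∑ b ∈ s g,
    |⟪v, nv a b⟫_ℝ| * fa a b) with hY
  have hthree := three_dir_abs_sum_le hu hw hm₀ hum hwm hwu hw₂ hw₃
  -- per pair of grains
  set φ : E3 → Fin n → Fin n → ℝ := fun v f g =>
    if τ f = τ g then 0 else ∑ a ∈ s f, ∑ b ∈ s g, |⟪v, nv a b⟫_ℝ| * fa a b with hφ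
  set ψ : Fin n → Fin n → ℝ := fun f g =>
    if τ f = τ g then 0 else ∑ a ∈ s f, ∑ b ∈ s g, Real.sqrt (1 - ⟪nv a b, m₀⟫_ℝ ^ 2) * fa a b with hψ
  have hφψ : ∀ f g, φ w f g + φ w₂ f g + φ w₃ f g ≤ 2 * ψ f g := by
    intro f g
    by_cases hfg : τ f = τ g
    · simp only [hφ, hψ, if_pos hfg]; norm_num
    · simp only [hφ, hψ, if_neg hfg]
      have hne : f ≠ g := fun h => hfg (h ▸ rfl)
      rw [← Finset.sum_add_distrib, ← Finset.sum_add_distrib, Finset.mul_sum]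
      refine Finset.sum_le_sum fun a ha => ?_
      rw [← Finset.sum_add_distrib, ← Finset.sum_add_distrib, Finset.mul_sum]
      refine Finset.sum_le_sum fun b hb => ?_
      have hab : a ≠ b := fun h => Finset.disjoint_left.1 (hsdisj f g hne) ha (h ▸ hb)
      have hν : ‖nv a b‖ = 1 := (hplane a b hab).1
      have h := mul_le_mul_of_nonneg_right (hthree (nv a b) hν) (hfa0 a b)
      linarith only [h]
  have hψ0 : ∀ f g, 0 ≤ ψ f g := by
    intro f g
    simp only [hψ]
    split_ifs
    · exact le_rfl
    · exact Finset.sum_nonneg fun a _ => Finset.sum_nonneg fun b _ =>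
        mul_nonneg (Real.sqrt_nonneg _) (hfa0 a b)
  -- the walls of the texture
  have hwall : ∀ f g, 2 / (3 * Real.sqrt 6) * ψ f g ≤
      (if f = g then 0 else c f g / 2 * ι (Dsc (m f g)) (G f) (G g)) := by
    intro f g
    by_cases hfg : f = g
    · subst hfg; simp [hψ]
    · rw [if_neg hfg]
      have hDc : IsCompact (Dsc (m f g)) :=
        Metric.isCompact_of_isClosed_isBounded
          ((isClosed_le continuous_norm continuous_const).inter
            (isClosed_eq (continuous_id.inner continuous_const) continuous_const))
          (Metric.isBounded_closedBall.subset (cruxDisc_subset_closedBall (m f g)))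
      have hι0 : 0 ≤ ι (Dsc (m f g)) (G f) (G g) := by
        show 0 ≤ (Per (Dsc (m f g)) (G f) + Per (Dsc (m f g)) (G g) - Per (Dsc (m f g)) (G f ∪ G g)) / 2
        have h := iota_nonneg_of_poly G (fun f => by
            rw [hGs]; exact ⟨(s f).card, fun i => Hc ((s f).equivFin.symm i), by
              ext x; simp only [mem_iUnion, exists_prop]
              constructor
              · rintro ⟨j, hj, hx⟩; exact ⟨(s f).equivFin ⟨j, hj⟩, by simpa using hx⟩
              · rintro ⟨i, hx⟩; exact ⟨_, ((s f).equivFin.symm i).2, hx⟩⟩)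
          hvol hdisjG hDc (convex_cruxDisc (m f g)) (zero_mem_cruxDisc (m f g)) hfg
        exact div_nonneg h (by norm_num)
      by_cases hτfg : τ f = τ g
      · simp only [hψ, if_pos hτfg, mul_zero]
        exact mul_nonneg (div_nonneg (hc0 f g hfg) (by norm_num)) hι0
      · simp only [hψ, if_neg hτfg]
        have hmfg : m f g = m₀ := hmax f g hfg hτfg
        have hcfg : 4 / (3 * Real.sqrt 6) ≤ c f g := hc f g hfg hτfg
        have hιlow : ∑ a ∈ s f, ∑ b ∈ s g, Real.sqrt (1 - ⟪nv a b, m₀⟫_ℝ ^ 2) * fa a b ≤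
            ι (Dsc m₀) (G f) (G g) := by
          have h := sinSum_le_iota_of_polytopeCalculus hPC hm₀ Hc nv hbd hdisjQ hanti hplane
            (hsdisj f g hfg)
          have e1 : (⋃ j ∈ s f, polytope (Hc j)) = G f := (hGs f).symm
          have e2 : (⋃ j ∈ s g, polytope (Hc j)) = G g := (hGs g).symm
          have e3 : (⋃ j ∈ s f ∪ s g, polytope (Hc j)) = G f ∪ G g := by
            rw [Finset.set_biUnion_union, e1, e2]
          rw [e1, e2, e3] at h
          exact h
        rw [hmfg] at hι0 ⊢
        have hZfg0 := hψ0 f g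
        simp only [hψ, if_neg hτfg] at hZfg0
        have e : 2 / (3 * Real.sqrt 6) = (4 / (3 * Real.sqrt 6)) / 2 := by ring
        rw [e]
        have p1 := mul_le_mul_of_nonneg_left hιlow (show (0:ℝ) ≤ 4 / (3 * Real.sqrt 6) / 2 by positivity)
        have p2 := mul_le_mul_of_nonneg_right hcfg hι0
        linarith only [p1, p2]
  -- assemble
  have R₁' : 6 * (2 : ℝ) ^ ((1 : ℝ) / 3) * (Real.sqrt 2 * (volume (⋃ f, G f)).toReal) ^ ((2 : ℝ) / 3) ≤
      (∑ f, Per (W (A f)) (G f) - ∑ f, ∑ g, (if f = g then 0 else ι (W (A f)) (G f) (G g))) +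
        1 / Real.sqrt 6 * ∑ f, ∑ g, φ w f g := R₁
  have R₂' : 6 * (2 : ℝ) ^ ((1 : ℝ) / 3) * (Real.sqrt 2 * (volume (⋃ f, G f)).toReal) ^ ((2 : ℝ) / 3) ≤
      (∑ f, Per (W (A f)) (G f) - ∑ f, ∑ g, (if f = g then 0 else ι (W (A f)) (G f) (G g))) +
        1 / Real.sqrt 6 * ∑ f, ∑ g, φ w₂ f g := R₂
  have R₃' : 6 * (2 : ℝ) ^ ((1 : ℝ) / 3) * (Real.sqrt 2 * (volume (⋃ f, G f)).toReal) ^ ((2 : ℝ) / 3) ≤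
      (∑ f, Per (W (A f)) (G f) - ∑ f, ∑ g, (if f = g then 0 else ι (W (A f)) (G f) (G g))) +
        1 / Real.sqrt 6 * ∑ f, ∑ g, φ w₃ f g := R₃
  have hsum3 : (∑ f, ∑ g, φ w f g) + (∑ f, ∑ g, φ w₂ f g) + (∑ f, ∑ g, φ w₃ f g) ≤
      2 * ∑ f, ∑ g, ψ f g := by
    rw [← Finset.sum_add_distrib, ← Finset.sum_add_distrib, Finset.mul_sum]
    refine Finset.sum_le_sum fun f _ => ?_
    rw [← Finset.sum_add_distrib, ← Finset.sum_add_distrib, Finset.mul_sum]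
    exact Finset.sum_le_sum fun g _ => hφψ f g
  have hwallsum : 2 / (3 * Real.sqrt 6) * ∑ f, ∑ g, ψ f g ≤
      ∑ f, ∑ g, (if f = g then 0 else c f g / 2 * ι (Dsc (m f g)) (G f) (G g)) := by
    rw [Finset.mul_sum]
    refine Finset.sum_le_sum fun f _ => ?_
    rw [Finset.mul_sum]
    exact Finset.sum_le_sum fun g _ => hwall f g
  show 6 * (2 : ℝ) ^ ((1 : ℝ) / 3) * (Real.sqrt 2 * (volume (⋃ f, G f)).toReal) ^ ((2 : ℝ) / 3) ≤
    ∑ f, Per (W (A f)) (G f) - ∑ f, ∑ g, (if f = g then 0 else ι (W (A f)) (G f) (G g)) +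
      ∑ f, ∑ g, (if f = g then 0 else c f g / 2 * ι (Dsc (m f g)) (G f) (G g))
  have h6 : (0 : ℝ) < Real.sqrt 6 := Real.sqrt_pos.2 (by norm_num)
  have hkey : 1 / Real.sqrt 6 * ((∑ f, ∑ g, φ w f g) + (∑ f, ∑ g, φ w₂ f g) + (∑ f, ∑ g, φ w₃ f g)) ≤
      3 * (2 / (3 * Real.sqrt 6) * ∑ f, ∑ g, ψ f g) := by
    have e : 3 * (2 / (3 * Real.sqrt 6) * ∑ f, ∑ g, ψ f g) = 1 / Real.sqrt 6 * (2 * ∑ f, ∑ g, ψ f g) := by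
      field_simp
    rw [e]
    exact mul_le_mul_of_nonneg_left hsum3 (by positivity)
  linarith only [R₁', R₂', R₃', hkey, hwallsum]

end Summit.Ventures.Crystal3D.Cruxes.PolycrystalWulffBound.PolyDensity

end
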